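import Literature.NumberTheory.ComplexMultiplication.EllipticUnits.ImaginaryQuadraticMainConjectureCarriersOLevels
import Literature.NumberTheory.GaloisRepresentations.RelativeCorestrictionNaturality
import HarnessLib

/-!
# [JLK 2011] §3.3 (5)–(6): the transfer `⊗ t_p(χ)` from the untwisted to the `𝒪_p(χ)`-twisted level cohomology —
# `H^i(G_S(F), μ_{p^k} ⊗ θ₀) → H^i(G_S(F), 𝒪 ⊗ μ_{p^k} ⊗ θ)` for `F` killing `θ₀` and `θ`

INPUTS hand `bsd-inputs-honda-p1` g22 (prover-bsd-inputs-honda-p1-g22-0), third brick of row D2-O-EXIST of crux L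
`SmallImageLowerHalfBothSigns` (stmt-BirchSwinnertonDyer-23599), line `rtt_w3`, LEAD `cruxlead-stmt-BirchSwinnertonDyer-23599` g9:
the UNIT HALF of `Nonempty (TwistedIwasawaDataO …)` (pins (Z1)/(Z2) of `…CarriersO`) reads Kato's norm-compatible elliptic units
through "`Kummer_k ⊗ t_p(χ)`" (§3.3 (5)–(6), Def. 3.5, §5.2); this file is the `⊗ t_p(χ)` step, so that the `ℤ_p` Kummer
system of route C (`θ₀ = 1`, `…Theorems.PrintCf2.TwistedZeta.exists_katoKummerSystem`) can be pushed into the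
`𝒪`-coefficient level groups of `…CarriersO` at the Kato levels `F = K(p^s𝔣) ⊇ K(𝔣_χ)` (where `χ` is trivial) and THEN
corestricted in the twisted cohomology (Burungale–Flach, proof of Lemma 7: "`_𝔞ζ_{K_n}(χ) = tr_{K(𝔣_χp^{r+n})/K_n}(_𝔞z ⊗ t(χ))`").
Statement-free plumbing (definitions by Mathlib's functoriality of continuous cohomology + their laws); no named fact,
no axiom, no `sorry`; nothing about BSD or Cor. 5.3 is proved here.

WHAT (all for `θ₀ : Γ_K → ℤ_p^×`, `θ : Γ_K → 𝒪^×` trivial on `N_S` and on the open `U = Gal(K̄/F)`):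
* §1 `oneTmul S n : μ_n → 𝒪 ⊗ μ_n`, `ζ ↦ 1 ⊗ ζ` (`t_p(χ) = 1 ∈ 𝒪_p(χ)`, Def. 1.1), `oneTmul_mu_of_apply_eq_one` (where `θ` is
  trivial it intertwines `σ` with `θ ⊗ σ`), `oMuRed_oneTmul`.
* §2 `coeffTransferO` (on `N_S`-invariants), `levelTransferHomO` (a morphism of topological `U_S`-modules),
  **`levelTransferO S P θ₀ θ U … k i : levelCoh p P θ₀ U k i →+ levelCohO S P θ U k i`** (`H^i(⊗ t_p(χ))`),
  **`isTwistedKummerClassO_levelTransferO`**: the transfer of a twisted Kummer class of `β` (`IsTwistedKummerClass`) is the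
  `t_p(χ) ⊗` Kummer class of `β` (`IsTwistedKummerClassO`, values `1 ⊗ σ(β)/β`).
* §3 the laws: **`levelConjO_levelTransferO`** `conj_γ (T c) = θ(γ) · T (conj_γ c)` for `θ₀(γ) = 1` (the `θ`-scalar conjugation
  law — how `χ(σ_𝔞)` of `N𝔞 − χ(σ_𝔞)⁻¹σ_𝔞` (§5.1) appears on transferred classes; tree `cohomologyMap_conjMap` with
  `λ' = θ(γ)⁻¹·T`), **`levelRedO_levelTransferO`** (`T` commutes with the reductions `ζ ↦ ζ^p`),
  **`relCoresO_levelTransferO`** (`T` commutes with `cor_{F'/F}` for `F ⊆ F'` both killing the characters — every degree, by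
  the tree's `cor_cohomologyMap_all` and pointwise functoriality for `toSubgroupOf`).
NOT here (successor): the `𝒪` Kato–Kummer system `c^𝒪_{𝔞,s,k} := T (c_{𝔞,s,k})`, its tower bookkeeping (`relCoresO` transitivity,
`relCoresO ∘ levelRedO`), `proj (nsubEltO • x)` and the assembly `exists_twistedIwasawaDataO` (see the `…CarriersOExist` docstring).

References: J. Johnson-Leung, G. Kings, *On the equivariant main conjecture for imaginary quadratic fields*, J. reine angew.
Math. 653 (2011) = arXiv:0804.2828, Def. 1.1, §3.3 (5)–(6), Def. 3.5, §4.2, §5.1–5.2; A. Burungale, M. Flach (2024) §4.1 Lemma 7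
(proof); K. Kato, Astérisque 295 (2004) §8.2; J.-P. Serre, *Local Fields*, VII §5; Neukirch–Schmidt–Wingberg, I §5.
-/

noncomputable section

open scoped NumberField TensorProduct
open CategoryTheory Field IsDedekindDomain
open Literature.NumberTheory.GaloisRepresentations
open Literature.NumberTheory.GaloisRepresentations.DiscreteGaloisModule
open Literature.NumberTheory.EllipticCurves

namespace Literature.NumberTheory.ComplexMultiplication.EllipticUnits.JohnsonLeungKings2011

/-! ## §1 `ζ ↦ t_p(χ) ⊗ ζ = 1 ⊗ ζ`: from `μ_{p^k}` (trivial twist) to `𝒪 ⊗ μ_{p^k} ⊗ θ` where `θ` is trivial -/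

section OneTmul

variable {K : Type} [Field K] {p : ℕ} [Fact p.Prime] (S : Set (PadicAlgCl p))
  (θ : absoluteGaloisGroup K →ₜ* (padicCoeffIntegers S)ˣ)

/-- **`⊗ t_p(χ)`: the map `μ_n(K̄) → 𝒪 ⊗ μ_n(K̄)`, `ζ ↦ 1 ⊗ ζ`** (`t_p(χ) = 1 ∈ 𝒪 = 𝒪_p(χ)` the generator of Def. 1.1).
[cite: JohnsonLeungKings2011, §3.3 (5) ("⊗ t_p(η)", arXiv p0010:L61–70) and §5.2 (p0014:L100)] -/
def oneTmul (n : ℕ) : MuCarrier K n →+ OMuCarrier K S n where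
  toFun v := OMuCarrier.tmul 1 v
  map_zero' := by
    change OMuCarrier.toTensor.symm ((1 : padicCoeffIntegers S) ⊗ₜ (0 : MuCarrier K n)) = 0
    rw [TensorProduct.tmul_zero, map_zero]
  map_add' v w := by
    change OMuCarrier.toTensor.symm ((1 : padicCoeffIntegers S) ⊗ₜ (v + w)) =
      OMuCarrier.toTensor.symm ((1 : padicCoeffIntegers S) ⊗ₜ v) + OMuCarrier.toTensor.symm ((1 : padicCoeffIntegers S) ⊗ₜ w)
    rw [TensorProduct.tmul_add, map_add]

/-- Unfolding `oneTmul`. [cite: JohnsonLeungKings2011, §3.3 (5) (arXiv p0010:L61–70)] -/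
@[simp] theorem oneTmul_apply (n : ℕ) (v : MuCarrier K n) : oneTmul S n v = OMuCarrier.tmul (1 : padicCoeffIntegers S) v := rfl

/-- **Where `θ` is trivial, `⊗ t_p(χ)` intertwines the untwisted action on `μ_{p^k}` with the `θ`-twisted action on
`𝒪 ⊗ μ_{p^k}`** (over `K(𝔣_χ)` the sheaf `𝒪_p(χ)` is constant, §3.3). [cite: JohnsonLeungKings2011, §3.3 display after (5) (arXiv p0010:L63–68)] -/
theorem oneTmul_mu_of_apply_eq_one (k : ℕ) {σ : absoluteGaloisGroup K} (hσ : θ σ = 1) (v : MuCarrier K (p ^ k)) :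
    oneTmul S (p ^ k) (mu K (p ^ k) σ v) = muTwistO S θ k σ (oneTmul S (p ^ k) v) := by
  rw [oneTmul_apply, oneTmul_apply, muTwistO_tmul_of_apply_eq_one S θ k hσ]

/-- `⊗ t_p(χ)` commutes with the reductions `ζ ↦ ζ^p`. [cite: Kato2004Asterisque, §8.2 (p. 180)] -/
theorem oMuRed_oneTmul (k : ℕ) (v : MuCarrier K (p ^ (k + 1))) :
    oMuRed S k (oneTmul S (p ^ (k + 1)) v) = oneTmul S (p ^ k) (muPowMap K (pow_dvd_pow p (Nat.le_succ k)) v) := rfl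

end OneTmul

/-! ## §2 The transfer on level groups `H^i(G_S(F), μ_{p^k} ⊗ θ₀) → H^i(G_S(F), 𝒪 ⊗ μ_{p^k} ⊗ θ)` for `F` killing `θ₀`, `θ` -/

section Level

variable {K : Type} [Field K] [NumberField K] {p : ℕ} [Fact p.Prime] (S : Set (PadicAlgCl p))
  (P : Set (HeightOneSpectrum (𝓞 K))) (θ₀ : absoluteGaloisGroup K →ₜ* ℤ_[p]ˣ)
  (θ : absoluteGaloisGroup K →ₜ* (padicCoeffIntegers S)ˣ)

/-- **`⊗ t_p(χ)` on the `N_S`-invariants**, under: `θ₀` and `θ` trivial on `N_S` (both unramified outside `S`).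
[cite: JohnsonLeungKings2011, §3.3 (5) and §4.2 (arXiv p0010:L61–70, p0012:L72–78)] -/
def coeffTransferO (hθ₀N : ∀ g ∈ ramificationSubgroup K P, θ₀ g = 1) (hθN : ∀ g ∈ ramificationSubgroup K P, θ g = 1) (k : ℕ) :
    Representation.invariants ((muTwist p θ₀ k).toRepresentation.comp (ramificationSubgroup K P).subtype) →ₗ[ℤ]
      Representation.invariants ((muTwistO S θ k).toRepresentation.comp (ramificationSubgroup K P).subtype) where
  toFun w := ⟨oneTmul S (p ^ k) (w : MuCarrier K (p ^ k)), by
    rw [Representation.mem_invariants]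
    intro g
    have hg := (Representation.mem_invariants _ _).mp w.2 g
    simp only [MonoidHom.coe_comp, Subgroup.coe_subtype, Function.comp_apply,
      ContinuousRep.toRepresentation_apply] at hg ⊢
    rw [muTwist_apply_of_apply_eq_one p θ₀ k (hθ₀N g g.2)] at hg
    rw [← oneTmul_mu_of_apply_eq_one S θ k (hθN g g.2), hg]⟩
  map_add' _ _ := Subtype.ext (map_add _ _ _)
  map_smul' c w := Subtype.ext (map_zsmul (oneTmul S (p ^ k)) c _)

omit [NumberField K] in
/-- `⊗ t_p(χ)` intertwines the two `G_S`-actions at every `τ` killing both characters (on underlying tensors).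
[cite: JohnsonLeungKings2011, §3.3 (5) (arXiv p0010:L61–70)] -/
theorem coe_coeffTransferO_apply (hθ₀N : ∀ g ∈ ramificationSubgroup K P, θ₀ g = 1)
    (hθN : ∀ g ∈ ramificationSubgroup K P, θ g = 1) (k : ℕ) {τ : absoluteGaloisGroup K} (hτ₀ : θ₀ τ = 1) (hτ : θ τ = 1)
    (w : Representation.invariants ((muTwist p θ₀ k).toRepresentation.comp (ramificationSubgroup K P).subtype)) :
    ((coeffTransferO S P θ₀ θ hθ₀N hθN k ((coeffGS p P θ₀ k) (toUnramifiedQuot K P τ) w) :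
        Representation.invariants ((muTwistO S θ k).toRepresentation.comp (ramificationSubgroup K P).subtype)) :
        OMuCarrier K S (p ^ k)) =
      (((coeffGSO S P θ k) (toUnramifiedQuot K P τ) (coeffTransferO S P θ₀ θ hθ₀N hθN k w) :
        Representation.invariants ((muTwistO S θ k).toRepresentation.comp (ramificationSubgroup K P).subtype)) :
        OMuCarrier K S (p ^ k)) := by
  change oneTmul S (p ^ k) (muTwist p θ₀ k τ (w : MuCarrier K (p ^ k))) =
    muTwistO S θ k τ (oneTmul S (p ^ k) (w : MuCarrier K (p ^ k)))
  rw [muTwist_apply_of_apply_eq_one p θ₀ k hτ₀, oneTmul_mu_of_apply_eq_one S θ k hτ]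

/-- **The transfer as a morphism of topological `U_S`-modules `(μ_{p^k} ⊗ θ₀)|_{U_S} → (𝒪 ⊗ μ_{p^k} ⊗ θ)|_{U_S}`** for an open
`U ≤ Γ_K` on which BOTH `θ₀` and `θ` are trivial (e.g. `U = Gal(K̄/K(p^s𝔣))`, `θ₀ = 1`).
[cite: JohnsonLeungKings2011, §3.3 (5) (arXiv p0010:L61–70)] -/
def levelTransferHomO (U : Subgroup (absoluteGaloisGroup K))
    (hθ₀N : ∀ g ∈ ramificationSubgroup K P, θ₀ g = 1) (hθN : ∀ g ∈ ramificationSubgroup K P, θ g = 1)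
    (hθ₀U : ∀ g ∈ U, θ₀ g = 1) (hθU : ∀ g ∈ U, θ g = 1) (k : ℕ) :
    (levelRep p P θ₀ U k).toTopRep ⟶ (levelRepO S P θ U k).toTopRep :=
  TopRep.ofHom ⟨⟨coeffTransferO S P θ₀ θ hθ₀N hθN k, continuous_of_discreteTopology⟩, fun g ↦ by
    ext w
    obtain ⟨g, hg⟩ := g
    obtain ⟨τ, hτ, rfl⟩ := Subgroup.mem_map.mp hg
    exact coe_coeffTransferO_apply S P θ₀ θ hθ₀N hθN k (hθ₀U τ hτ) (hθU τ hτ) w⟩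

/-- **The transfer `H^i(G_S(F), μ_{p^k} ⊗ θ₀) → H^i(G_S(F), 𝒪 ⊗ μ_{p^k} ⊗ θ)`** (`⊗ t_p(χ)` on cohomology, §3.3 (5)), for `F`
on whose Galois group both characters are trivial. [cite: JohnsonLeungKings2011, §3.3 (5)–(6) (arXiv p0010:L55–80)] -/
def levelTransferO (U : Subgroup (absoluteGaloisGroup K))
    (hθ₀N : ∀ g ∈ ramificationSubgroup K P, θ₀ g = 1) (hθN : ∀ g ∈ ramificationSubgroup K P, θ g = 1)
    (hθ₀U : ∀ g ∈ U, θ₀ g = 1) (hθU : ∀ g ∈ U, θ g = 1) (k i : ℕ) :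
    levelCoh p P θ₀ U k i →+ levelCohO S P θ U k i :=
  (ContinuousCohomology.map (ContinuousMonoidHom.id _) (levelTransferHomO S P θ₀ θ U hθ₀N hθN hθ₀U hθU k) i).hom.toLinearMap.toAddMonoidHom

omit [NumberField K] in
/-- Unfolding `levelTransferO`. [cite: JohnsonLeungKings2011, §3.3 (5) (arXiv p0010:L61–70)] -/
theorem levelTransferO_apply (U : Subgroup (absoluteGaloisGroup K))
    (hθ₀N : ∀ g ∈ ramificationSubgroup K P, θ₀ g = 1) (hθN : ∀ g ∈ ramificationSubgroup K P, θ g = 1)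
    (hθ₀U : ∀ g ∈ U, θ₀ g = 1) (hθU : ∀ g ∈ U, θ g = 1) (k i : ℕ) (c : levelCoh p P θ₀ U k i) :
    levelTransferO S P θ₀ θ U hθ₀N hθN hθ₀U hθU k i c =
      (ContinuousCohomology.map (ContinuousMonoidHom.id _) (levelTransferHomO S P θ₀ θ U hθ₀N hθN hθ₀U hθU k) i).hom c :=
  rfl

omit [NumberField K] in
/-- **The transfer carries twisted Kummer classes to `t_p(χ) ⊗` twisted Kummer classes**: if `c` is the Kummer class of `β`
in `H¹(G_S(F), μ_{p^k} ⊗ θ₀)` (`IsTwistedKummerClass`) then its transfer is the class of `β` in `H¹(G_S(F), 𝒪 ⊗ μ_{p^k} ⊗ θ)`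
(`IsTwistedKummerClassO`: cocycle values `1 ⊗ σ(β)/β`). [cite: JohnsonLeungKings2011, §3.3 (5)–(6) and Def. 3.5 (arXiv p0010:L55–80)] -/
theorem isTwistedKummerClassO_levelTransferO (U : Subgroup (absoluteGaloisGroup K))
    (hθ₀N : ∀ g ∈ ramificationSubgroup K P, θ₀ g = 1) (hθN : ∀ g ∈ ramificationSubgroup K P, θ g = 1)
    (hθ₀U : ∀ g ∈ U, θ₀ g = 1) (hθU : ∀ g ∈ U, θ g = 1) (k : ℕ) (β : (AlgebraicClosure K)ˣ)
    (c : levelCoh p P θ₀ U k 1) (hc : IsTwistedKummerClass p θ₀ P U k β c) :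
    IsTwistedKummerClassO S θ P U k β (levelTransferO S P θ₀ θ U hθ₀N hθN hθ₀U hθU k 1 c) := by
  obtain ⟨φ, hφ, hval⟩ := hc
  refine ⟨contOneCocycles.pullback (ContinuousMonoidHom.id _) (levelTransferHomO S P θ₀ θ U hθ₀N hθN hθ₀U hθU k) φ,
    ?_, fun σ hσ ↦ ?_⟩
  · rw [← hφ, levelTransferO_apply]
    exact (map_oneCocycleClass _ _ _ φ).symm
  · refine ⟨(φ.1 ⟨toUnramifiedQuot K P σ, Subgroup.mem_map_of_mem _ hσ⟩ :
        Representation.invariants ((muTwist p θ₀ k).toRepresentation.comp (ramificationSubgroup K P).subtype)),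
      hval σ hσ, ?_⟩
    rw [contOneCocycles.pullback_apply]
    rfl

/-! ## §3 The transfer commutes with the reductions, the corestrictions, and (up to `θ(γ)`) with conjugation -/

/-- `θ(γ)⁻¹ · T` as a morphism of `U_S`-modules (the conjugate `λ^g = g⁻¹ λ g` of the transfer `λ = T`). [folklore] -/
private def scaledTransferHomO (U : Subgroup (absoluteGaloisGroup K))
    (hθ₀N : ∀ g ∈ ramificationSubgroup K P, θ₀ g = 1) (hθN : ∀ g ∈ ramificationSubgroup K P, θ g = 1)
    (hθ₀U : ∀ g ∈ U, θ₀ g = 1) (hθU : ∀ g ∈ U, θ g = 1) (k : ℕ) (c₀ : padicCoeffIntegers S) :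
    (levelRep p P θ₀ U k).toTopRep ⟶ (levelRepO S P θ U k).toTopRep :=
  levelTransferHomO S P θ₀ θ U hθ₀N hθN hθ₀U hθU k ≫ levelMapHomO S P θ U (oMuScalar S (p ^ k) c₀) (oMuScalar_muTwistO S θ k c₀)

omit [NumberField K] in
/-- `g · (θ(γ)⁻¹ T)(v) = T (g · v)` for `g` the image of `γ`, `θ₀(γ) = 1`. [folklore] -/
private theorem ρ_scaledTransferHomO (U : Subgroup (absoluteGaloisGroup K))
    (hθ₀N : ∀ g ∈ ramificationSubgroup K P, θ₀ g = 1) (hθN : ∀ g ∈ ramificationSubgroup K P, θ g = 1)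
    (hθ₀U : ∀ g ∈ U, θ₀ g = 1) (hθU : ∀ g ∈ U, θ g = 1) (k : ℕ) {γ : absoluteGaloisGroup K} (hγ₀ : θ₀ γ = 1)
    (v : (levelRep p P θ₀ U k).toTopRep) :
    (coeffGSO S P θ k).toTopRep.ρ (toUnramifiedQuot K P γ)
        ((scaledTransferHomO S P θ₀ θ U hθ₀N hθN hθ₀U hθU k (((θ γ)⁻¹ : (padicCoeffIntegers S)ˣ) : padicCoeffIntegers S)).hom v) =
      (levelTransferHomO S P θ₀ θ U hθ₀N hθN hθ₀U hθU k).hom ((coeffGS p P θ₀ k).toTopRep.ρ (toUnramifiedQuot K P γ) v) := by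
  apply Subtype.ext
  change muTwistO S θ k γ (oMuScalar S (p ^ k) (((θ γ)⁻¹ : (padicCoeffIntegers S)ˣ) : padicCoeffIntegers S)
      (oneTmul S (p ^ k) (v : MuCarrier K (p ^ k)))) =
    oneTmul S (p ^ k) (muTwist p θ₀ k γ (v : MuCarrier K (p ^ k)))
  rw [muTwist_apply_of_apply_eq_one p θ₀ k hγ₀, oneTmul_apply, oneTmul_apply, oMuScalar_tmul, muTwistO_tmul, mul_one,
    Units.mul_inv]

omit [NumberField K] in
/-- `H^i(θ(γ)⁻¹ T) = θ(γ)⁻¹ · H^i(T)` (pointwise functoriality). [folklore] -/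
private theorem cohomologyMap_scaledTransferHomO (U : Subgroup (absoluteGaloisGroup K))
    (hθ₀N : ∀ g ∈ ramificationSubgroup K P, θ₀ g = 1) (hθN : ∀ g ∈ ramificationSubgroup K P, θ g = 1)
    (hθ₀U : ∀ g ∈ U, θ₀ g = 1) (hθU : ∀ g ∈ U, θ g = 1) (k i : ℕ) (c₀ : padicCoeffIntegers S) (c : levelCoh p P θ₀ U k i) :
    cohomologyMap (scaledTransferHomO S P θ₀ θ U hθ₀N hθN hθ₀U hθU k c₀) i c =
      levelScalarO S P θ U k i c₀ (levelTransferO S P θ₀ θ U hθ₀N hθN hθ₀U hθU k i c) := by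
  rw [levelScalarO_apply, levelTransferO_apply]
  have h := map_comp_apply_of (ContinuousMonoidHom.id (imGS P U)) (ContinuousMonoidHom.id (imGS P U))
    (ContinuousMonoidHom.id (imGS P U)) (fun _ ↦ rfl) (levelTransferHomO S P θ₀ θ U hθ₀N hθN hθ₀U hθU k)
    (levelMapHomO S P θ U (oMuScalar S (p ^ k) c₀) (oMuScalar_muTwistO S θ k c₀))
    (resIdHom (scaledTransferHomO S P θ₀ θ U hθ₀N hθN hθ₀U hθU k c₀)) (fun _ ↦ rfl) i c
  exact h

omit [NumberField K] in
/-- **The `θ`-scalar conjugation law of the transfer**: for `γ ∈ Γ_K` with `θ₀(γ) = 1`,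
`conj_γ (T c) = θ(γ) · T (conj_γ c)` — on coefficients `γ·(1 ⊗ ζ) = θ(γ) ⊗ γζ = θ(γ)·(1 ⊗ γζ)` (the tree's
`cohomologyMap_conjMap` with `λ' = θ(γ)⁻¹·λ`). This is how `χ(σ_𝔞)` enters `N𝔞 − χ(σ_𝔞)⁻¹σ_𝔞` (§5.1) for transferred classes.
[cite: JohnsonLeungKings2011, §3.3 (5) and §5.1 (arXiv p0010:L61–70, p0014:L18–26)] [cite: SerreLocalFields1979, VII §5] -/
theorem levelConjO_levelTransferO (U : Subgroup (absoluteGaloisGroup K)) [U.Normal]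
    (hθ₀N : ∀ g ∈ ramificationSubgroup K P, θ₀ g = 1) (hθN : ∀ g ∈ ramificationSubgroup K P, θ g = 1)
    (hθ₀U : ∀ g ∈ U, θ₀ g = 1) (hθU : ∀ g ∈ U, θ g = 1) (k i : ℕ) {γ : absoluteGaloisGroup K} (hγ₀ : θ₀ γ = 1)
    (c : levelCoh p P θ₀ U k i) :
    levelConjO S P θ U k i γ (levelTransferO S P θ₀ θ U hθ₀N hθN hθ₀U hθU k i c) =
      levelScalarO S P θ U k i ((θ γ : (padicCoeffIntegers S)ˣ) : padicCoeffIntegers S)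
        (levelTransferO S P θ₀ θ U hθ₀N hθN hθ₀U hθU k i (levelConj p P θ₀ U k i γ c)) := by
  haveI : (imGS P U).Normal := by
    unfold imGS
    exact Subgroup.Normal.map inferInstance _ (toUnramifiedQuot_surjective K P)
  -- `T (conj_γ c) = conj_γ (θ(γ)⁻¹ · T c)` (`cohomologyMap_conjMap` with `λ' = θ(γ)⁻¹ T`)
  have hconj := cohomologyMap_conjMap (X := (coeffGS p P θ₀ k).toTopRep) (N := imGS P U) (X' := (coeffGSO S P θ k).toTopRep)
    (levelTransferHomO S P θ₀ θ U hθ₀N hθN hθ₀U hθU k)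
    (scaledTransferHomO S P θ₀ θ U hθ₀N hθN hθ₀U hθU k (((θ γ)⁻¹ : (padicCoeffIntegers S)ˣ) : padicCoeffIntegers S))
    (toUnramifiedQuot K P γ) (fun v ↦ by
      have e := congrArg ((coeffGSO S P θ k).toTopRep.ρ (toUnramifiedQuot K P γ)⁻¹)
        (ρ_scaledTransferHomO S P θ₀ θ U hθ₀N hθN hθ₀U hθU k hγ₀ v)
      rw [ρ_inv_apply_ρ_apply] at e
      exact e) i c
  have key : levelTransferO S P θ₀ θ U hθ₀N hθN hθ₀U hθU k i (levelConj p P θ₀ U k i γ c) =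
      levelConjO S P θ U k i γ (levelScalarO S P θ U k i (((θ γ)⁻¹ : (padicCoeffIntegers S)ˣ) : padicCoeffIntegers S)
        (levelTransferO S P θ₀ θ U hθ₀N hθN hθ₀U hθU k i c)) :=
    hconj.trans (congrArg (fun z ↦ conjMap (coeffGSO S P θ k).toTopRep (imGS P U) (toUnramifiedQuot K P γ) i z)
      (cohomologyMap_scaledTransferHomO S P θ₀ θ U hθ₀N hθN hθ₀U hθU k i _ c))
  rw [key, ← levelScalarO_levelConjO, ← levelScalarO_mul, Units.mul_inv, levelScalarO_one]

omit [NumberField K] in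
/-- **Transfer ∘ reduction = reduction ∘ transfer** (`1 ⊗ ζ^p = (id ⊗ pow)(1 ⊗ ζ)`).
[cite: Kato2004Asterisque, §8.2 (p. 180)] [cite: JohnsonLeungKings2011, §3.3 (5) (arXiv p0010:L61–70)] -/
theorem levelRedO_levelTransferO (U : Subgroup (absoluteGaloisGroup K))
    (hθ₀N : ∀ g ∈ ramificationSubgroup K P, θ₀ g = 1) (hθN : ∀ g ∈ ramificationSubgroup K P, θ g = 1)
    (hθ₀U : ∀ g ∈ U, θ₀ g = 1) (hθU : ∀ g ∈ U, θ g = 1) (k i : ℕ) (c : levelCoh p P θ₀ U (k + 1) i) :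
    levelRedO S P θ U k i (levelTransferO S P θ₀ θ U hθ₀N hθN hθ₀U hθU (k + 1) i c) =
      levelTransferO S P θ₀ θ U hθ₀N hθN hθ₀U hθU k i (levelRed p P θ₀ U k i c) := by
  -- the common diagonal `H^i(1 ⊗ (ζ ↦ ζ^p))`
  let D : (levelRep p P θ₀ U (k + 1)).toTopRep ⟶ (levelRepO S P θ U k).toTopRep :=
    levelRedHom p P θ₀ U k ≫ levelTransferHomO S P θ₀ θ U hθ₀N hθN hθ₀U hθU k
  rw [levelRedO_apply, levelRed_apply]
  change (ContinuousCohomology.map _ _ i).hom ((ContinuousCohomology.map _ _ i).hom c) =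
    (ContinuousCohomology.map _ _ i).hom ((ContinuousCohomology.map _ _ i).hom c)
  have h1 := map_comp_apply_of (ContinuousMonoidHom.id (imGS P U)) (ContinuousMonoidHom.id (imGS P U))
    (ContinuousMonoidHom.id (imGS P U)) (fun _ ↦ rfl)
    (levelTransferHomO S P θ₀ θ U hθ₀N hθN hθ₀U hθU (k + 1)) (levelMapHomO S P θ U (oMuRed S k) (oMuRed_muTwistO S θ k))
    D (fun _ ↦ rfl) i c
  have h2 := map_comp_apply_of (ContinuousMonoidHom.id (imGS P U)) (ContinuousMonoidHom.id (imGS P U))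
    (ContinuousMonoidHom.id (imGS P U)) (fun _ ↦ rfl)
    (levelRedHom p P θ₀ U k) (levelTransferHomO S P θ₀ θ U hθ₀N hθN hθ₀U hθU k) D (fun _ ↦ rfl) i c
  exact h1.symm.trans h2

/-- **Transfer ∘ corestriction = corestriction ∘ transfer** for open `U' ≤ U` on which both characters are trivial
(naturality of `relCor` in the `U_S`-morphism `⊗ t_p(χ)`, every degree: `toSubgroupOf` by pointwise functoriality, `cor` by
`cor_cohomologyMap_all`). [cite: NeukirchSchmidtWingberg2008, I §5 Prop. 1.5.2] [cite: JohnsonLeungKings2011, §3.3 (5) and Def. 3.5 (arXiv p0010:L55–80)] -/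
theorem relCoresO_levelTransferO {U U' : Subgroup (absoluteGaloisGroup K)} (h : U' ≤ U)
    (hU : IsOpen (U : Set (absoluteGaloisGroup K))) (hU' : IsOpen (U' : Set (absoluteGaloisGroup K)))
    (hθ₀N : ∀ g ∈ ramificationSubgroup K P, θ₀ g = 1) (hθN : ∀ g ∈ ramificationSubgroup K P, θ g = 1)
    (hθ₀U : ∀ g ∈ U, θ₀ g = 1) (hθU : ∀ g ∈ U, θ g = 1) (k i : ℕ) (c : levelCoh p P θ₀ U' k i) :
    relCoresO S P θ h hU hU' k i
        (levelTransferO S P θ₀ θ U' hθ₀N hθN (fun g hg ↦ hθ₀U g (h hg)) (fun g hg ↦ hθU g (h hg)) k i c) =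
      levelTransferO S P θ₀ θ U hθ₀N hθN hθ₀U hθU k i (relCores p P θ₀ h hU hU' k i c) := by
  haveI : TotallyDisconnectedSpace (GaloisGroupUnramifiedOutside K P) :=
    Literature.GroupTheory.ProfiniteSubquotients.totallyDisconnectedSpace_quotient
      (ramificationSubgroup K P) (ramificationSubgroup_isClosed K P)
  haveI hVc : IsClosed (imGS P U : Set (GaloisGroupUnramifiedOutside K P)) :=
    Subgroup.isClosed_of_isOpen _ (isOpenMap_toUnramifiedQuot K P _ hU)
  haveI hV'c : IsClosed (imGS P U' : Set (GaloisGroupUnramifiedOutside K P)) :=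
    Subgroup.isClosed_of_isOpen _ (isOpenMap_toUnramifiedQuot K P _ hU')
  haveI : CompactSpace (imGS P U) := isCompact_iff_compactSpace.mp hVc.isCompact
  haveI : IsClosed (((imGS P U').subgroupOf (imGS P U) : Subgroup (imGS P U)) : Set (imGS P U)) :=
    hV'c.preimage continuous_subtype_val
  haveI : ((imGS P U').subgroupOf (imGS P U)).FiniteIndex := by
    haveI : DiscreteTopology (GaloisGroupUnramifiedOutside K P ⧸ imGS P U') :=
      QuotientGroup.discreteTopology (isOpenMap_toUnramifiedQuot K P _ hU')
    haveI : Finite (GaloisGroupUnramifiedOutside K P ⧸ imGS P U') := finite_of_compact_of_discrete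
    haveI : (imGS P U').FiniteIndex := Subgroup.finiteIndex_of_finite_quotient
    infer_instance
  letI : Fintype (↥(imGS P U) ⧸ (imGS P U').subgroupOf (imGS P U)) := Fintype.ofFinite _
  -- names
  let V : Subgroup (GaloisGroupUnramifiedOutside K P) := imGS P U
  let V' : Subgroup (GaloisGroupUnramifiedOutside K P) := imGS P U'
  have hle : V' ≤ V := Subgroup.map_mono h
  let FV : (levelRep p P θ₀ U k).toTopRep ⟶ (levelRepO S P θ U k).toTopRep :=
    levelTransferHomO S P θ₀ θ U hθ₀N hθN hθ₀U hθU k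
  let FV' : (levelRep p P θ₀ U' k).toTopRep ⟶ (levelRepO S P θ U' k).toTopRep :=
    levelTransferHomO S P θ₀ θ U' hθ₀N hθN (fun g hg ↦ hθ₀U g (h hg)) (fun g hg ↦ hθU g (h hg)) k
  -- step A: `toSubgroupOf` is natural in the `V`-morphism `FV` (both composites = the map of the pair `(V'.subgroupOf V ≅ V', ⊗ t_p)`)
  let Fpair : TopRep.res ((subgroupOfHom hle : (V'.subgroupOf V : Subgroup V) →ₜ* V') :
        (V'.subgroupOf V : Subgroup V) →* V') (levelRep p P θ₀ U' k).toTopRep ⟶ (repSub V V' (coeffGSO S P θ k)).toTopRep :=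
    TopRep.ofHom ⟨⟨coeffTransferO S P θ₀ θ hθ₀N hθN k, continuous_of_discreteTopology⟩, fun s ↦ by
      ext w
      obtain ⟨⟨g, hgV⟩, hs⟩ := s
      obtain ⟨τ, hτ, hτg⟩ := Subgroup.mem_map.mp (Subgroup.mem_subgroupOf.mp hs)
      subst hτg
      exact coe_coeffTransferO_apply S P θ₀ θ hθ₀N hθN k (hθ₀U τ (h hτ)) (hθU τ (h hτ)) w⟩
  have hA : toSubgroupOf (coeffGSO S P θ k).toTopRep hle i ((ContinuousCohomology.map (ContinuousMonoidHom.id _) FV' i).hom c) =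
      cohomologyMap (resModHom (V'.subgroupOf V) FV) i (toSubgroupOf (coeffGS p P θ₀ k).toTopRep hle i c) := by
    have h1 := map_comp_apply_of (X := (levelRep p P θ₀ U' k).toTopRep) (Y := (levelRepO S P θ U' k).toTopRep)
      (Z := (repSub V V' (coeffGSO S P θ k)).toTopRep) (ContinuousMonoidHom.id V') (subgroupOfHom hle) (subgroupOfHom hle)
      (fun _ ↦ rfl) FV' (TopRep.ofHom ⟨ContinuousLinearMap.id ℤ _, fun _ ↦ rfl⟩) Fpair (fun _ ↦ rfl) i c
    have h2 := map_comp_apply_of (X := (levelRep p P θ₀ U' k).toTopRep) (Y := (repSub V V' (coeffGS p P θ₀ k)).toTopRep)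
      (Z := (repSub V V' (coeffGSO S P θ k)).toTopRep) (subgroupOfHom hle) (ContinuousMonoidHom.id _) (subgroupOfHom hle)
      (fun _ ↦ rfl) (TopRep.ofHom ⟨ContinuousLinearMap.id ℤ _, fun _ ↦ rfl⟩)
      (resIdHom (resModHom (V'.subgroupOf V) FV)) Fpair (fun _ ↦ rfl) i c
    exact h1.symm.trans h2
  -- step B: `cor` is natural in `FV`, every degree
  have hB := cor_cohomologyMap_all (V'.subgroupOf V) (levelRep p P θ₀ U k) (levelRepO S P θ U k) FV i
    (toSubgroupOf (coeffGS p P θ₀ k).toTopRep hle i c)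
  change (cor ((imGS P U').subgroupOf (imGS P U)) (levelRepO S P θ U k) i).hom
      ((toSubgroupOf (coeffGSO S P θ k).toTopRep hle i).hom ((ContinuousCohomology.map (ContinuousMonoidHom.id _) FV' i).hom c)) =
    (ContinuousCohomology.map (ContinuousMonoidHom.id _) FV i).hom
      ((cor ((imGS P U').subgroupOf (imGS P U)) (levelRep p P θ₀ U k) i).hom ((toSubgroupOf (coeffGS p P θ₀ k).toTopRep hle i).hom c))
  exact (congrArg _ hA).trans hB

end Level

end Literature.NumberTheory.ComplexMultiplication.EllipticUnits.JohnsonLeungKings2011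

end
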